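import Literature.Geometry.Riemannian.WeightedHeatFlowFromLinearHeat
import Literature.Geometry.Riemannian.ShrinkerPotentialGrowthProofs
import Mathlib.Analysis.SpecialFunctions.SmoothTransition
import HarnessLib

/-!
# The localised maximum principle on a complete gradient shrinking Ricci soliton
# (Munteanu–Wang 2015, proof of Prop. 1.3)

On a Riemannian gradient shrinking Ricci soliton `Ric + Hess f = ½ g`, normalised by
`S + |∇f|² = f`, with `S ≥ 0` and proper potential (compact sub-level sets `{f ≤ c}`; for complete
shrinkers this is Haslhofer–Müller 2011, Lemma 2.1), a smooth function `u` satisfying the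
differential inequality `Δ_f u = Δu − ⟨∇f, ∇u⟩ ≥ α u² − β` (`α > 0`) on `{f ≥ r₀}` is bounded
above. This is the maximum-principle half of O. Munteanu, J. Wang, *Geometry of shrinking Ricci
solitons*, Compositio Math. 151 (2015), proof of Prop. 1.3 (arXiv:1410.3813, pp. 5–6), isolated
from the curvature identities it is applied to there (`u = |Ric|² S^{-a}`) and in the proof of their
Thm. 1.4 (bounded `S` forces bounded `|Ric|` and `|Rm|` on four-dimensional shrinkers): the
Omori–Yau maximum principle is replaced by the cut-off `Θ_A(f)` supported in the compact
`{f ≤ 2A}` together with the identity `Δ_f f = n/2 − f` (trace of the soliton equation).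

* `Shrinker.exists_contDiff_cutoffSq` — a `C²` cut-off `ψ` (`ψ = 1` on `(-∞, ½]`, `ψ = 0` on
  `[1, ∞)`, `0 ≤ ψ ≤ 1`, `ψ' ≤ 0`, `|ψ'|, |ψ''| ≤ K`, `ψ'² ≤ K ψ` on `[0, 1]`; the cut-off of
  Zhang 2009, proof of Thm. 1.3, Step 1, with its smoothness recorded);
* `Shrinker.exists_contDiff_cutoff_family` — `Θ_A = ψ(·/(2A))`, `A ≥ 1`, and the uniform bound
  `−(Θ''Φ + Θ'(μ − t)) + 2Θ'²Φ/Θ ≤ K` whenever `Θ(t) > 0`, `0 ≤ Φ ≤ t` (`μ ≥ 0` fixed);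
* `Shrinker.cutoff_max_algebra` — the bookkeeping at the maximum point;
* `Shrinker.cutoff_mul_le_of_isLocalMax` — the second-order test at a local maximum `p` of
  `G = Θ(f) u` on a Riemannian manifold: `ΔG(p) ≤ 0`, `dG(p) = 0`, the product and chain rules
  for `Δ_g`, whence `G(p) ≤ max(1, (|β| + K)/α)`;
* `Shrinker.bounded_of_drift_laplacian_ge_sq` — the maximum principle itself (any model space).

Everything is proved; no definitions and no named facts are introduced.

## References

* [MunteanuWang2015] O. Munteanu, J. Wang, *Geometry of shrinking Ricci solitons*, Compositio
  Math. 151 (2015) 2273–2300 = arXiv:1410.3813, proof of Prop. 1.3 (pp. 5–6), Thm. 1.4.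
* [Zhang2009] Z.-H. Zhang, *On the completeness of gradient Ricci solitons*, Proc. AMS 137 (2009)
  2755–2759, proof of Thm. 1.3, Step 1 (the cut-off).
* [HaslhoferMuller2011] R. Haslhofer, R. Müller, *A compactness theorem for complete Ricci
  shrinkers*, GAFA 21 (2011), Lemma 2.1 (properness of the potential).
-/

noncomputable section

open Set Filter Module
open scoped Manifold ContDiff Topology

namespace Literature.Geometry.Riemannian

open Lorentzian Lorentzian.PseudoRiemannianMetric

namespace Shrinker

/-! ### One-variable calculus: a `C²` cut-off with the quotient bound `ψ'² ≤ K ψ` -/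

/-- **A `C²` cut-off with controlled first two derivatives** (the cut-off of Zhang 2009, proof
of Thm. 1.3, Step 1, here with its smoothness recorded): there are `ψ : ℝ → ℝ` of class `C²`
and `K ≥ 0` with `ψ = 1` on `(-∞, ½]`, `ψ = 0` on `[1, ∞)`, `0 ≤ ψ ≤ 1`, `ψ' ≤ 0`, and on
`[0, 1]` the bounds `|ψ'| ≤ K`, `|ψ''| ≤ K`, `ψ'² ≤ K ψ`. Construction: `ψ = η²`,
`η(t) = Real.smoothTransition (2 − 2t)` (so `ψ'² = 4η²η'² ≤ 4‖η'‖²_∞ ψ`).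
Adapted from `Zhang2009.exists_cutoffSq` (which records `HasDerivAt` only). [folklore] -/
theorem exists_contDiff_cutoffSq : ∃ (ψ : ℝ → ℝ) (K : ℝ), ContDiff ℝ 2 ψ ∧
    (∀ t, t ≤ 1 / 2 → ψ t = 1) ∧ (∀ t, 1 ≤ t → ψ t = 0) ∧ (∀ t, 0 ≤ ψ t ∧ ψ t ≤ 1) ∧
    (∀ t, deriv ψ t ≤ 0) ∧ 0 ≤ K ∧ (∀ t ∈ Icc (0 : ℝ) 1, |deriv ψ t| ≤ K) ∧
    (∀ t ∈ Icc (0 : ℝ) 1, |deriv (deriv ψ) t| ≤ K) ∧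
    (∀ t ∈ Icc (0 : ℝ) 1, deriv ψ t ^ 2 ≤ K * ψ t) := by
  set η : ℝ → ℝ := fun t ↦ Real.smoothTransition (2 - 2 * t) with hη
  have hηs : ContDiff ℝ ∞ η :=
    Real.smoothTransition.contDiff.comp (contDiff_const.sub (contDiff_const.mul contDiff_id))
  have hηd : Differentiable ℝ η := (contDiff_infty_iff_deriv.1 hηs).1
  have hη's : ContDiff ℝ ∞ (deriv η) := (contDiff_infty_iff_deriv.1 hηs).2
  have hη'd : Differentiable ℝ (deriv η) := (contDiff_infty_iff_deriv.1 hη's).1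
  have hη''s : ContDiff ℝ ∞ (deriv (deriv η)) := (contDiff_infty_iff_deriv.1 hη's).2
  have h1 : ∀ t, HasDerivAt η (deriv η t) t := fun t ↦ (hηd t).hasDerivAt
  have h2 : ∀ t, HasDerivAt (deriv η) (deriv (deriv η) t) t := fun t ↦ (hη'd t).hasDerivAt
  have hanti : Antitone η := fun a b hab ↦
    Real.smoothTransition.monotone (by linarith)
  have hone : ∀ t, t ≤ 1 / 2 → η t = 1 := fun t ht ↦
    Real.smoothTransition.one_of_one_le (by linarith)
  have hzero : ∀ t, 1 ≤ t → η t = 0 := fun t ht ↦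
    Real.smoothTransition.zero_of_nonpos (by linarith)
  have hnn : ∀ t, 0 ≤ η t := fun t ↦ Real.smoothTransition.nonneg _
  have hle : ∀ t, η t ≤ 1 := fun t ↦ Real.smoothTransition.le_one _
  have hη'le : ∀ t, deriv η t ≤ 0 := fun t ↦ hanti.deriv_nonpos
  -- bounds on `[0, 1]`
  obtain ⟨K₁, hK₁⟩ := isCompact_Icc.exists_bound_of_continuousOn (s := Icc (0 : ℝ) 1)
    hη's.continuous.continuousOn
  obtain ⟨K₂, hK₂⟩ := isCompact_Icc.exists_bound_of_continuousOn (s := Icc (0 : ℝ) 1)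
    hη''s.continuous.continuousOn
  have hK₁' : ∀ t ∈ Icc (0 : ℝ) 1, |deriv η t| ≤ K₁ := fun t ht ↦ by
    simpa [Real.norm_eq_abs] using hK₁ t ht
  have hK₂' : ∀ t ∈ Icc (0 : ℝ) 1, |deriv (deriv η) t| ≤ K₂ := fun t ht ↦ by
    simpa [Real.norm_eq_abs] using hK₂ t ht
  have hK₁0 : 0 ≤ K₁ := (abs_nonneg _).trans (hK₁' 0 ⟨le_rfl, zero_le_one⟩)
  have hK₂0 : 0 ≤ K₂ := (abs_nonneg _).trans (hK₂' 0 ⟨le_rfl, zero_le_one⟩)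
  -- the square and its first two derivatives
  set ψ : ℝ → ℝ := fun t ↦ η t * η t with hψ
  have hψ' : ∀ t, HasDerivAt ψ (2 * η t * deriv η t) t := fun t ↦
    ((h1 t).fun_mul (h1 t)).congr_deriv (by ring)
  have hd1 : deriv ψ = fun t ↦ 2 * η t * deriv η t := funext fun t ↦ (hψ' t).deriv
  have hψ'' : ∀ t, HasDerivAt (deriv ψ)
      (2 * deriv η t * deriv η t + 2 * η t * deriv (deriv η) t) t := fun t ↦ by
    rw [hd1]
    exact ((h1 t).const_mul 2).fun_mul (h2 t)
  have hd2 : ∀ t, deriv (deriv ψ) t = 2 * deriv η t * deriv η t + 2 * η t * deriv (deriv η) t :=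
    fun t ↦ (hψ'' t).deriv
  have hψs : ContDiff ℝ 2 ψ := (hηs.mul hηs).of_le (WithTop.coe_le_coe.mpr le_top)
  refine ⟨ψ, 4 * K₁ ^ 2 + 2 * K₁ + 2 * K₂, hψs, fun t ht ↦ ?_, fun t ht ↦ ?_,
    fun t ↦ ⟨mul_self_nonneg _, ?_⟩, fun t ↦ ?_, by positivity, fun t ht ↦ ?_, fun t ht ↦ ?_,
    fun t ht ↦ ?_⟩
  · simp [hψ, hone t ht]
  · simp [hψ, hzero t ht]
  · have := mul_le_mul (hle t) (hle t) (hnn t) zero_le_one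
    simpa [hψ] using this
  · rw [hd1]
    exact mul_nonpos_of_nonneg_of_nonpos (mul_nonneg zero_le_two (hnn t)) (hη'le t)
  · rw [hd1]
    dsimp only
    rw [abs_mul, abs_mul, abs_of_nonneg (zero_le_two : (0 : ℝ) ≤ 2), abs_of_nonneg (hnn t)]
    have := hK₁' t ht
    have h3 : 2 * η t * |deriv η t| ≤ 2 * 1 * K₁ :=
      mul_le_mul (by linarith [hle t]) this (abs_nonneg _) (by norm_num)
    nlinarith
  · rw [hd2]
    have ha := hK₁' t ht
    have hb := hK₂' t ht
    have h3 : |2 * deriv η t * deriv η t| ≤ 2 * K₁ ^ 2 := by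
      rw [abs_mul, abs_mul, abs_of_nonneg (zero_le_two : (0 : ℝ) ≤ 2)]
      nlinarith [abs_nonneg (deriv η t)]
    have h4 : |2 * η t * deriv (deriv η) t| ≤ 2 * K₂ := by
      rw [abs_mul, abs_mul, abs_of_nonneg (zero_le_two : (0 : ℝ) ≤ 2), abs_of_nonneg (hnn t)]
      have : 2 * η t * |deriv (deriv η) t| ≤ 2 * 1 * K₂ :=
        mul_le_mul (by linarith [hle t]) hb (abs_nonneg _) (by norm_num)
      linarith
    calc |2 * deriv η t * deriv η t + 2 * η t * deriv (deriv η) t|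
        ≤ |2 * deriv η t * deriv η t| + |2 * η t * deriv (deriv η) t| := abs_add_le _ _
      _ ≤ 2 * K₁ ^ 2 + 2 * K₂ := add_le_add h3 h4
      _ ≤ 4 * K₁ ^ 2 + 2 * K₁ + 2 * K₂ := by nlinarith
  · rw [hd1]
    dsimp only
    have ha := hK₁' t ht
    have hsq : deriv η t ^ 2 ≤ K₁ ^ 2 := by
      have := abs_le_abs_of_nonneg (abs_nonneg (deriv η t)) ha
      nlinarith [abs_nonneg (deriv η t), sq_abs (deriv η t)]
    have hψ0 : 0 ≤ η t * η t := mul_self_nonneg _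
    calc (2 * η t * deriv η t) ^ 2 = 4 * deriv η t ^ 2 * (η t * η t) := by ring
      _ ≤ 4 * K₁ ^ 2 * (η t * η t) := by gcongr
      _ ≤ (4 * K₁ ^ 2 + 2 * K₁ + 2 * K₂) * (η t * η t) := by gcongr; nlinarith

/-- **The cut-off family of the localised maximum principle** (the cut-off of Zhang 2009, proof
of Thm. 1.3, Step 1, rescaled to the potential as in Munteanu–Wang 2015, proof of Prop. 1.3:
`Θ_A(t) = ψ(t/(2A))`). For every `μ ≥ 0` there is `K ≥ 0` such that for every `A ≥ 1` there is
`Θ : ℝ → ℝ` of class `C²` with `Θ = 1` on `(-∞, A]`, `Θ = 0` on `[2A, ∞)`, `0 ≤ Θ ≤ 1`, and,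
whenever `Θ(t) > 0` and `0 ≤ Φ ≤ t`, the drift bound
`-(Θ''(t) Φ + Θ'(t) (μ - t)) + 2 Θ'(t)² Φ / Θ(t) ≤ K` (uniformly in `A`): with
`s = t/(2A) ∈ [0, 1)`, `-Θ''Φ ≤ K₀ · 2A/(4A²)`, `-Θ'μ ≤ K₀ μ/(2A)`, `Θ' t ≤ 0`,
`2Θ'²Φ/Θ ≤ 2K₀ψ · 2A/(4A²ψ)`. [folklore] -/
theorem exists_contDiff_cutoff_family {μ : ℝ} (hμ : 0 ≤ μ) : ∃ K : ℝ, 0 ≤ K ∧ ∀ A : ℝ, 1 ≤ A →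
    ∃ Θ : ℝ → ℝ, ContDiff ℝ 2 Θ ∧ (∀ t, t ≤ A → Θ t = 1) ∧ (∀ t, 2 * A ≤ t → Θ t = 0) ∧
      (∀ t, 0 ≤ Θ t ∧ Θ t ≤ 1) ∧
      (∀ t Φ : ℝ, 0 < Θ t → 0 ≤ Φ → Φ ≤ t →
        -(deriv (deriv Θ) t * Φ + deriv Θ t * (μ - t)) + 2 * deriv Θ t ^ 2 * Φ / Θ t ≤ K) := by
  obtain ⟨ψ, K₀, hψs, hone, hzero, h01, hψ'le, hK₀, hb1, hb2, hb3⟩ := exists_contDiff_cutoffSq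
  refine ⟨K₀ * (μ + 3) / 2, by positivity, fun A hA ↦ ?_⟩
  have hA0 : 0 < A := by linarith
  have h2A : 0 < 2 * A := by linarith
  have hψd : Differentiable ℝ ψ := hψs.differentiable (by norm_num)
  have hψ'd : Differentiable ℝ (deriv ψ) := hψs.differentiable_deriv_two
  have hd : ∀ t : ℝ, HasDerivAt (fun t : ℝ ↦ t / (2 * A)) (1 / (2 * A)) t := fun t ↦
    (hasDerivAt_id' t).div_const (2 * A)
  have hΘ' : ∀ t, HasDerivAt (fun t ↦ ψ (t / (2 * A))) (deriv ψ (t / (2 * A)) / (2 * A)) t :=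
    fun t ↦ (((hψd _).hasDerivAt).comp t (hd t)).congr_deriv (by ring)
  have hdΘ : deriv (fun t ↦ ψ (t / (2 * A))) = fun t ↦ deriv ψ (t / (2 * A)) / (2 * A) :=
    funext fun t ↦ (hΘ' t).deriv
  have hdΘt : ∀ t, deriv (fun t ↦ ψ (t / (2 * A))) t = deriv ψ (t / (2 * A)) / (2 * A) :=
    fun t ↦ (hΘ' t).deriv
  have hd2Θt : ∀ t, deriv (deriv fun t ↦ ψ (t / (2 * A))) t =
      deriv (deriv ψ) (t / (2 * A)) / (2 * A) / (2 * A) := fun t ↦ by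
    rw [hdΘ]
    exact (((((hψ'd _).hasDerivAt).comp t (hd t)).div_const (2 * A)).congr_deriv (by ring)).deriv
  have hΘs : ContDiff ℝ 2 (fun t ↦ ψ (t / (2 * A))) := hψs.comp (contDiff_id.div_const _)
  refine ⟨fun t ↦ ψ (t / (2 * A)), hΘs, fun t ht ↦ ?_, fun t ht ↦ ?_, fun t ↦ h01 _,
    fun t Φ hpos hΦ0 hΦt ↦ ?_⟩
  · exact hone _ (by rw [div_le_iff₀ h2A]; linarith)
  · exact hzero _ ((one_le_div h2A).2 ht)
  · rw [hd2Θt t, hdΘt t]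
    beta_reduce at hpos ⊢
    set s : ℝ := t / (2 * A) with hs
    have ht0 : 0 ≤ t := hΦ0.trans hΦt
    have hs0 : 0 ≤ s := div_nonneg ht0 h2A.le
    have hs1 : s < 1 := not_le.mp fun h ↦ hpos.ne' (hzero s h)
    have ht2A : t < 2 * A := (div_lt_one h2A).1 hs1
    have hΦ2A : Φ ≤ 2 * A := by linarith
    have hsI : s ∈ Icc (0 : ℝ) 1 := ⟨hs0, hs1.le⟩
    -- (i) the second-derivative term
    have h1 : -(deriv (deriv ψ) s / (2 * A) / (2 * A) * Φ) ≤ K₀ / 2 := by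
      have hm : -deriv (deriv ψ) s ≤ K₀ := (neg_le_abs _).trans (hb2 s hsI)
      have key : -deriv (deriv ψ) s * Φ ≤ K₀ * (2 * A) :=
        (mul_le_mul_of_nonneg_right hm hΦ0).trans (mul_le_mul_of_nonneg_left hΦ2A hK₀)
      rw [show -(deriv (deriv ψ) s / (2 * A) / (2 * A) * Φ) =
        -deriv (deriv ψ) s * Φ / (2 * A) / (2 * A) by ring]
      have h1a : -deriv (deriv ψ) s * Φ / (2 * A) ≤ K₀ := by
        rw [div_le_iff₀ h2A]; exact key
      have h1b : -deriv (deriv ψ) s * Φ / (2 * A) / (2 * A) ≤ K₀ / (2 * A) :=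
        div_le_div_of_nonneg_right h1a h2A.le
      have h1c : K₀ / (2 * A) ≤ K₀ / 2 :=
        div_le_div_of_nonneg_left hK₀ (by norm_num) (by linarith)
      exact h1b.trans h1c
    -- (ii) the drift term: `-Θ' μ ≤ K₀ μ / 2` and `Θ' t ≤ 0`
    have h2 : -(deriv ψ s / (2 * A) * (μ - t)) ≤ K₀ * μ / 2 := by
      have hm : -deriv ψ s ≤ K₀ := (neg_le_abs _).trans (hb1 s hsI)
      have h2a : -(deriv ψ s / (2 * A)) * μ ≤ K₀ / 2 * μ := by
        refine mul_le_mul_of_nonneg_right ?_ hμ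
        rw [neg_div', div_le_iff₀ h2A]  -- -ψ' ≤ K₀/2 * (2A)
        nlinarith
      have h2b : deriv ψ s / (2 * A) * t ≤ 0 :=
        mul_nonpos_of_nonpos_of_nonneg (div_nonpos_of_nonpos_of_nonneg (hψ'le s) h2A.le) ht0
      nlinarith
    -- (iii) the gradient term, by the quotient bound `ψ'² ≤ K₀ ψ`
    have h3 : 2 * (deriv ψ s / (2 * A)) ^ 2 * Φ / ψ s ≤ K₀ := by
      have key : deriv ψ s ^ 2 * Φ ≤ K₀ * ψ s * (2 * A) :=
        (mul_le_mul_of_nonneg_right (hb3 s hsI) hΦ0).trans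
          (mul_le_mul_of_nonneg_left hΦ2A (mul_nonneg hK₀ (h01 s).1))
      rw [div_le_iff₀ hpos,
        show 2 * (deriv ψ s / (2 * A)) ^ 2 * Φ = deriv ψ s ^ 2 * Φ / (2 * A * A) by ring,
        div_le_iff₀ (by positivity)]
      calc deriv ψ s ^ 2 * Φ ≤ K₀ * ψ s * (2 * A) := key
        _ ≤ K₀ * ψ s * (2 * A * A) :=
          mul_le_mul_of_nonneg_left (by nlinarith) (mul_nonneg hK₀ (h01 s).1)
    have h4 : K₀ * (μ + 3) / 2 = K₀ / 2 + K₀ * μ / 2 + K₀ := by ring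
    rw [neg_add, h4]
    exact add_le_add (add_le_add h1 h2) h3

/-! ### The algebra at the maximum point -/

/-- **The bookkeeping at the maximum point of `G = Θ(f) u`** (Munteanu–Wang 2015, proof of
Prop. 1.3, the display after (1.7)). Write `θ = Θ(f(p)) ∈ (0, 1]`, `θ₁ = Θ'`, `θ₂ = Θ''`,
`U = u(p) > 0`, `Φ = |∇f|²(p)`, `L = Δu(p)`, `Lf = Δf(p)`, `D = ⟨∇f, ∇u⟩(p)`,
`X = ⟨∇Θ(f), ∇u⟩(p)`. If `Δ_f u ≥ αu² − β` at `p` (`hdrift`), `ΔG(p) ≤ 0` expanded by the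
product and chain rules (`hΔ`), the first-order condition `θ du = −U θ₁ df` in the forms
`θ D = −U θ₁ Φ`, `θ X = −U θ₁² Φ`, and the cut-off bound
`−(θ₂Φ + θ₁(Lf − Φ)) + 2θ₁²Φ/θ ≤ K`, then `θ²·hdrift + θ·hΔ` give
`α G² ≤ β θ² + G·[−(θ₂Φ + θ₁(Lf − Φ)) + 2θ₁²Φ/θ] ≤ |β| + G K`, whence
`G = θ U ≤ max(1, (|β| + K)/α)`. [folklore] -/
theorem cutoff_max_algebra {α β θ θ₁ θ₂ U Φ L Lf D X K : ℝ} (hα : 0 < α)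
    (hθ : 0 < θ) (hθ1 : θ ≤ 1) (hU : 0 < U)
    (hdrift : α * U ^ 2 - β ≤ L - D)
    (hΔ : θ * L + U * (θ₂ * Φ + θ₁ * Lf) + 2 * X ≤ 0)
    (hD : θ * D = -(U * θ₁ * Φ)) (hX : θ * X = -(U * θ₁ ^ 2 * Φ))
    (hE : -(θ₂ * Φ + θ₁ * (Lf - Φ)) + 2 * θ₁ ^ 2 * Φ / θ ≤ K) :
    θ * U ≤ max 1 ((|β| + K) / α) := by
  have hG0 : 0 < θ * U := mul_pos hθ hU
  have hE' : 2 * θ₁ ^ 2 * Φ ≤ (K + (θ₂ * Φ + θ₁ * (Lf - Φ))) * θ := by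
    rw [← div_le_iff₀ hθ]
    linarith
  have p1 := mul_le_mul_of_nonneg_left hdrift (sq_nonneg θ)
  have p2 := mul_le_mul_of_nonneg_left hΔ hθ.le
  have p3 := mul_le_mul_of_nonneg_left hE' hU.le
  have q1 : θ * (θ * D) = θ * -(U * θ₁ * Φ) := by rw [hD]
  have hkey : α * (θ * U) ^ 2 ≤ β * θ ^ 2 + θ * U * K := by linarith [p1, p2, p3, q1, hX]
  have hθsq : θ ^ 2 ≤ 1 := by nlinarith
  have hb : β * θ ^ 2 ≤ |β| := by
    have h1 := mul_le_mul_of_nonneg_right (le_abs_self β) (sq_nonneg θ)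
    have h2 := mul_le_of_le_one_right (abs_nonneg β) hθsq
    linarith
  rcases le_or_gt (θ * U) 1 with hle | hlt
  · exact hle.trans (le_max_left _ _)
  · refine le_trans ?_ (le_max_right _ _)
    rw [le_div_iff₀ hα]
    have h0 : |β| ≤ |β| * (θ * U) := le_mul_of_one_le_right (abs_nonneg β) hlt.le
    have h1 : α * (θ * U) * (θ * U) ≤ (|β| + K) * (θ * U) := by nlinarith [hkey, hb, h0]
    have h2 := le_of_mul_le_mul_right h1 hG0
    linarith

/-! ### The computation at the maximum point -/

section Manifold

variable {E : Type*} [NormedAddCommGroup E] [NormedSpace ℝ E] [FiniteDimensional ℝ E]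
  [CompleteSpace E] {H : Type*} [TopologicalSpace H] {I : ModelWithCorners ℝ E H} [I.Boundaryless]
  {M : Type*} [TopologicalSpace M] [ChartedSpace H M] [IsManifold I ∞ M]
  (g : PseudoRiemannianMetric I ∞ E (TangentSpace I : M → Type _)) [g.HasLeviCivita]

/-- **The second-order test at a maximum of `G = Θ(f)·u`** (Munteanu–Wang 2015, proof of
Prop. 1.3: "at the maximum point … `0 ≥ Δ_f G`"; here for a Riemannian `g`, `f, u` of class `C²`
at `p`, `Θ` of class `C²`). At a local maximum `p` of `G` with `Θ(f(p)) ∈ (0, 1]`, `u(p) > 0`: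
if `Δu − ⟨∇f, ∇u⟩ ≥ αu² − β` at `p` (`α > 0`), `Δf − |∇f|² = μ − f` at `p`, and the cut-off obeys
`−(Θ''|∇f|² + Θ'(μ − f)) + 2Θ'²|∇f|²/Θ ≤ K` at `p`, then `G(p) ≤ max(1, (|β| + K)/α)`.
Ingredients: `ΔG(p) ≤ 0` (`dalembertian_nonpos_of_isLocalMax`), `dG(p) = 0` (Fermat), the
product rule `Δ(ab) = aΔb + bΔa + 2⟨da, db⟩` (`dalembertian_fun_mul`), the chain rules
`Δ(Θ∘f) = Θ''|∇f|² + Θ'Δf`, `d(Θ∘f) = Θ' df`, and `cutoff_max_algebra`.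
[cite: MunteanuWang2015, Prop. 1.3 (proof)] -/
theorem cutoff_mul_le_of_isLocalMax (hg : g.IsRiemannian) {f u : M → ℝ} {Θ : ℝ → ℝ} {p : M}
    {α β K μ : ℝ} (hα : 0 < α)
    (hf : ContMDiffAt I 𝓘(ℝ, ℝ) 2 f p) (hu : ContMDiffAt I 𝓘(ℝ, ℝ) 2 u p) (hΘ : ContDiff ℝ 2 Θ)
    (hmax : IsLocalMax (fun y ↦ Θ (f y) * u y) p) (hθ : 0 < Θ (f p)) (hθ1 : Θ (f p) ≤ 1)
    (hU : 0 < u p)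
    (hdrift : α * u p ^ 2 - β ≤ g.dalembertian u p
      - g.innerDual p (mvfderiv I f p).toLinearMap (mvfderiv I u p).toLinearMap)
    (hff : g.dalembertian f p - g.gradSq f p = μ - f p)
    (hE : -(deriv (deriv Θ) (f p) * g.gradSq f p + deriv Θ (f p) * (μ - f p))
        + 2 * deriv Θ (f p) ^ 2 * g.gradSq f p / Θ (f p) ≤ K) :
    Θ (f p) * u p ≤ max 1 ((|β| + K) / α) := by
  -- regularity
  have hfd : MDifferentiableAt I 𝓘(ℝ, ℝ) f p := hf.mdifferentiableAt (by norm_num)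
  have hud : MDifferentiableAt I 𝓘(ℝ, ℝ) u p := hu.mdifferentiableAt (by norm_num)
  have hΘd : DifferentiableAt ℝ Θ (f p) := (hΘ.differentiable (by norm_num)) _
  have hA : ContMDiffAt I 𝓘(ℝ, ℝ) 2 (fun y ↦ Θ (f y)) p := hΘ.contDiffAt.comp_contMDiffAt hf
  have hAd : MDifferentiableAt I 𝓘(ℝ, ℝ) (fun y ↦ Θ (f y)) p := hA.mdifferentiableAt (by norm_num)
  have hG : ContMDiffAt I 𝓘(ℝ, ℝ) 2 (fun y ↦ Θ (f y) * u y) p := hA.mul hu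
  -- the second-order condition `Δ G (p) ≤ 0` and the first-order condition `dG (p) = 0`
  have hΔG : g.dalembertian (fun y ↦ Θ (f y) * u y) p ≤ 0 :=
    g.dalembertian_nonpos_of_isLocalMax hG hmax fun v hv ↦ hg p v hv
  have hcrit : mfderiv I 𝓘(ℝ, ℝ) (fun y ↦ Θ (f y) * u y) p = 0 :=
    Literature.Topology.FourManifolds.IsLocalMax.isMCriticalPt hmax
  have hdG : mvfderiv I (fun y ↦ Θ (f y) * u y) p = 0 := by
    ext v
    simp [mvfderiv, hcrit]
  -- the differentials: `d(Θ∘f) = Θ' df`, `d(Θ(f) u) = Θ(f) du + u d(Θ∘f) = 0`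
  have hdA : ∀ v, mvfderiv I (fun y ↦ Θ (f y)) p v = deriv Θ (f p) * mvfderiv I f p v :=
    fun v ↦ mvfderiv_real_comp (I := I) (ζ := Θ) hΘd hfd v
  have hprodd := mvfderiv_fun_mul hAd hud
  have hrel : ∀ v, Θ (f p) * mvfderiv I u p v = -(u p * deriv Θ (f p)) * mvfderiv I f p v := by
    intro v
    have h := congrArg (fun L : TangentSpace I p →L[ℝ] ℝ ↦ L v) hprodd
    simp only [hdG, _root_.zero_apply, _root_.add_apply, FunLike.coe_smul, Pi.smul_apply,
      smul_eq_mul, hdA] at h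
    linarith
  have hrelL : Θ (f p) • (mvfderiv I u p).toLinearMap =
      (-(u p * deriv Θ (f p))) • (mvfderiv I f p).toLinearMap := by
    ext v
    simp only [LinearMap.smul_apply, ContinuousLinearMap.coe_coe, smul_eq_mul]
    exact hrel v
  have hdAL : (mvfderiv I (fun y ↦ Θ (f y)) p).toLinearMap =
      deriv Θ (f p) • (mvfderiv I f p).toLinearMap := by
    ext v
    simp only [LinearMap.smul_apply, ContinuousLinearMap.coe_coe, smul_eq_mul]
    exact hdA v
  -- the product rule and the chain rule for `Δ`
  have hprod := dalembertian_fun_mul g hA hu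
  have hcomp : g.dalembertian (fun y ↦ Θ (f y)) p =
      deriv (deriv Θ) (f p) * g.gradSq f p + deriv Θ (f p) * g.dalembertian f p := by
    have h := g.dalembertian_real_comp (ζ := Θ) hf hΘ.contDiffAt
    rw [show (fun y ↦ Θ (f y)) = Θ ∘ f from rfl, h]
    rfl
  -- the first-order condition inside the two pairings
  have hD : Θ (f p) * g.innerDual p (mvfderiv I f p).toLinearMap (mvfderiv I u p).toLinearMap =
      -(u p * deriv Θ (f p) * g.gradSq f p) := by
    rw [← g.innerDual_smul_right, hrelL, g.innerDual_smul_right]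
    simp only [PseudoRiemannianMetric.gradSq]
    ring
  have hX : Θ (f p) * g.innerDual p (mvfderiv I (fun y ↦ Θ (f y)) p).toLinearMap
      (mvfderiv I u p).toLinearMap = -(u p * deriv Θ (f p) ^ 2 * g.gradSq f p) := by
    rw [← g.innerDual_smul_right, hrelL, g.innerDual_smul_right, hdAL, g.innerDual_smul_left]
    simp only [PseudoRiemannianMetric.gradSq]
    ring
  have hΔ : Θ (f p) * g.dalembertian u p
      + u p * (deriv (deriv Θ) (f p) * g.gradSq f p + deriv Θ (f p) * g.dalembertian f p)
      + 2 * g.innerDual p (mvfderiv I (fun y ↦ Θ (f y)) p).toLinearMap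
          (mvfderiv I u p).toLinearMap ≤ 0 := by
    rw [hprod, hcomp] at hΔG
    linarith
  have hE2 : -(deriv (deriv Θ) (f p) * g.gradSq f p
      + deriv Θ (f p) * (g.dalembertian f p - g.gradSq f p))
      + 2 * deriv Θ (f p) ^ 2 * g.gradSq f p / Θ (f p) ≤ K := by
    rw [hff]
    exact hE
  exact cutoff_max_algebra hα hθ hθ1 hU hdrift hΔ hD hX hE2

/-! ### The localised maximum principle -/

/-- **Localised maximum principle on a complete gradient shrinking soliton** (the argument of
Munteanu–Wang 2015, proof of Prop. 1.3, pp. 5–6, in abstract form; the Omori–Yau substitute of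
the proof of their Thm. 1.4). Let `(M, g, f)` be a Riemannian gradient shrinker,
`Ric + Hess f = ½ g`, normalised by `S + |∇f|² = f`, with `S ≥ 0` and compact sub-level sets
`{f ≤ c}` (properness of the potential, Haslhofer–Müller 2011, Lemma 2.1), and let `u` be a
smooth function with `Δ_f u = Δu − ⟨∇f, ∇u⟩ ≥ α u² − β` on `{f ≥ r₀}` for some `α > 0`. Then
`u` is bounded above. Proof: `u ≤ m₀` on the compact `{f ≤ r₀}`; for `x` with `u(x) > 0` put
`A = max(f(x), 1)` and `G = Θ_A(f) u` (`exists_contDiff_cutoff_family`, `μ = n/2`, so that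
`Δ_f f = n/2 − f` by the traced soliton equation `S + Δf = n/2`); `G` vanishes off the compact
`{f ≤ 2A}`, so its maximum there, at `p`, is a global maximum with `G(p) ≥ G(x) = u(x) > 0`;
either `f(p) < r₀` and `u(x) ≤ G(p) ≤ u(p) ≤ m₀`, or `cutoff_mul_le_of_isLocalMax` gives
`u(x) ≤ G(p) ≤ max(1, (|β| + K)/α)`. [cite: MunteanuWang2015, Prop. 1.3 (proof)] -/
theorem bounded_of_drift_laplacian_ge_sq (hg : g.IsRiemannian) {f u : M → ℝ} {α β r₀ : ℝ}
    (hα : 0 < α) (hK : ∀ c : ℝ, IsCompact {y : M | f y ≤ c})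
    (hf : ContMDiff I 𝓘(ℝ, ℝ) ∞ f) (hu : ContMDiff I 𝓘(ℝ, ℝ) ∞ u)
    (hsol : ∀ (x : M) (X Y : TangentSpace I x),
      g.ricci x X Y + g.hessian f x X Y = (1 / 2 : ℝ) * g.val x X Y)
    (hnorm : ∀ x : M, g.scalarCurvature x + g.gradSq f x = f x)
    (hR0 : ∀ x : M, 0 ≤ g.scalarCurvature x)
    (hdrift : ∀ x : M, r₀ ≤ f x → α * u x ^ 2 - β ≤ g.dalembertian u x
      - g.innerDual x (mvfderiv I f x).toLinearMap (mvfderiv I u x).toLinearMap) :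
    ∃ C : ℝ, ∀ x : M, u x ≤ C := by
  -- the traced soliton identity `Δf = n/2 − S`, whence `Δf − |∇f|² = n/2 − f`; `0 ≤ |∇f|² ≤ f`
  have hshr : g.IsGradientShrinker f 1 := (g.isGradientShrinker_one_iff f).2 hsol
  have hff : ∀ x, g.dalembertian f x - g.gradSq f x = (finrank ℝ E : ℝ) / 2 - f x := fun x ↦ by
    have h1 := hshr.scalarCurvature_add_dalembertian_one x
    have h2 := hnorm x
    linarith
  have hΦ0 : ∀ x, 0 ≤ g.gradSq f x := fun x ↦ g.gradSq_nonneg hg f x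
  have hΦle : ∀ x, g.gradSq f x ≤ f x := fun x ↦ by linarith [hR0 x, hnorm x]
  have hf2 : ∀ x, ContMDiffAt I 𝓘(ℝ, ℝ) 2 f x := fun x ↦
    (hf.of_le (WithTop.coe_le_coe.mpr le_top)).contMDiffAt
  have hu2 : ∀ x, ContMDiffAt I 𝓘(ℝ, ℝ) 2 u x := fun x ↦
    (hu.of_le (WithTop.coe_le_coe.mpr le_top)).contMDiffAt
  -- `u ≤ m₀` on the compact `{f ≤ r₀}`
  obtain ⟨m₀, hm₀⟩ := (hK r₀).bddAbove_image hu.continuous.continuousOn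
  -- the cut-off family with drift constant `μ = n/2`
  obtain ⟨K, -, hfam⟩ :=
    exists_contDiff_cutoff_family (μ := (finrank ℝ E : ℝ) / 2) (by positivity)
  refine ⟨max (max m₀ 0) (max 1 ((|β| + K) / α)), fun x ↦ ?_⟩
  rcases le_or_gt (u x) 0 with hux | hux
  · exact hux.trans ((le_max_right _ _).trans (le_max_left _ _))
  -- `u x > 0`: localise with `Θ_A(f)`, `A = max (f x) 1`
  set A : ℝ := max (f x) 1 with hA
  have hA1 : 1 ≤ A := le_max_right _ _
  have hAx : f x ≤ A := le_max_left _ _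
  obtain ⟨Θ, hΘs, hΘ1, hΘ0, hΘ01, hE⟩ := hfam A hA1
  set G : M → ℝ := fun y ↦ Θ (f y) * u y with hGdef
  have hGc : Continuous G := (hΘs.continuous.comp hf.continuous).mul hu.continuous
  have hxK : x ∈ {y : M | f y ≤ 2 * A} := by
    rw [mem_setOf_eq]
    linarith
  -- the maximum of `G` over the compact `{f ≤ 2A}` is a global maximum
  obtain ⟨p, -, hpmax⟩ := (hK (2 * A)).exists_isMaxOn ⟨x, hxK⟩ hGc.continuousOn
  have hGx : G x = u x := by simp only [hGdef, hΘ1 (f x) hAx, one_mul]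
  have hxp : u x ≤ G p := by
    rw [← hGx]
    exact hpmax hxK
  have hGp : 0 < G p := hux.trans_le hxp
  have hglob : ∀ y, G y ≤ G p := fun y ↦ by
    by_cases hy : f y ≤ 2 * A
    · exact hpmax hy
    · have : G y = 0 := by
        simp only [hGdef, hΘ0 (f y) (le_of_lt (not_le.1 hy)), zero_mul]
      rw [this]
      exact hGp.le
  -- at `p`: `Θ(f p) > 0`, `u p > 0`, `G p ≤ u p`
  have hθp : 0 < Θ (f p) := by
    rcases (hΘ01 (f p)).1.lt_or_eq with hlt | heq
    · exact hlt
    · exfalso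
      have : G p = 0 := by simp only [hGdef, ← heq, zero_mul]
      linarith
  have hup : 0 < u p := by
    by_contra hle
    have : G p ≤ 0 := mul_nonpos_of_nonneg_of_nonpos (hΘ01 (f p)).1 (not_lt.1 hle)
    linarith
  have hGp_le : G p ≤ u p := by
    have := mul_le_of_le_one_left hup.le (hΘ01 (f p)).2
    simpa only [hGdef] using this
  rcases lt_or_ge (f p) r₀ with hfp | hfp
  · -- the maximum sits in `{f < r₀}`, where `u ≤ m₀`
    have h1 : u p ≤ m₀ := hm₀ ⟨p, le_of_lt hfp, rfl⟩
    exact (hxp.trans (hGp_le.trans h1)).trans ((le_max_left _ _).trans (le_max_left _ _))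
  · -- the maximum sits in `{f ≥ r₀}`: the second-order test at `p`
    have hmax : IsLocalMax G p := Filter.Eventually.of_forall hglob
    have hEp := hE (f p) (g.gradSq f p) hθp (hΦ0 p) (hΦle p)
    have hstep : G p ≤ max 1 ((|β| + K) / α) :=
      cutoff_mul_le_of_isLocalMax g hg hα (hf2 p) (hu2 p) hΘs hmax hθp (hΘ01 (f p)).2 hup
        (hdrift p hfp) (hff p) hEp
    exact (hxp.trans hstep).trans (le_max_right _ _)

end Manifold

end Shrinker

end Literature.Geometry.Riemannian

end
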